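import Summits.KontsevichZagierPeriods.KontsevichZagierPeriods.Theorems.SymplecticScissorsRealOnePeriodRelationsStubTorsArcs
import Summits.KontsevichZagierPeriods.KontsevichZagierPeriods.Theorems.SymplecticScissorsRealOnePeriodRelationsStubRetractionPaths
import Summits.KontsevichZagierPeriods.KontsevichZagierPeriods.Theorems.SymplecticScissorsRealOnePeriodRelationsStubFormReductionPAux

/-!
# Crux `RealOnePeriodRelations` (stmt-KontsevichZagierPeriods-10042), line `nash-retraction-thin-strip`, reshape 10:
# transfer of symbols on `C_T` — the first- and second-kind pieces (towards the lead's stub `stub_transferTors`)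

For the torsion-punctured curve `C_T` (`curveP L T`) this file provides the elementary-relation bookkeeping that moves the
standard pieces of a form off `C_T`:

* `span_Theta0`, `span_Theta1` — `(C_T, ι^*θᵢ, γ) ∼ (E_L, θᵢ, ι ∘ γ)` ((R4) along `ι`);
* `span_dlogV` — `(C_T, dx/(x − t), γ) ∼ (𝔾ₘ, y dx, (x − t, (x − t)⁻¹) ∘ γ)` ((R4) along the unit `x − t`);
* `hasDerivAt_eval_psiP` — the chain rule along the parametrisation `ψ_T`;
* `vanishesOn_xi_twoTorsion`, `span_Xi_twoTorsion` — at a `2`-torsion abscissa `t` (`f(t) = 0`) the third-kind form is of the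
  second kind: `(f′(t)/2) ξ_t = ½ θ₁ − (t/2) θ₀ − d(y/(x − t))` on `C_T`, so `(C_T, ξ_t, γ)` is a combination of
  `(E_L, θ₀, ιγ)`, `(E_L, θ₁, ιγ)` and `𝟙`.

[cite: HuberWustholz2022, §13.1 (B), §13.2, §18.1] [cite: SilvermanAEC2009, III.5.1]
-/

noncomputable section

open scoped BigOperators Topology PeriodPair
open Set Filter MvPolynomial Complex
open Literature.NumberTheory.Transcendental Literature.NumberTheory.Transcendental.CurvePeriods
open Literature.NumberTheory.Transcendental.CurvePeriods.Ell

namespace Summit.KontsevichZagierPeriods.SymplecticScissors.RealOnePeriodRelations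

namespace TorsionLayer

set_option quotPrecheck false in
/-- Membership in the `ℚ̄`-span of the elementary relations (the conclusion format of `HuberWustholzCurvePeriods`). -/
local notation "InSpan" c:max => ∃ (k : ℕ) (ρ : Fin k → (PeriodSymbol →₀ ℂ)) (a : Fin k → ℂ),
  (∀ l, IsElementaryRelation (ρ l)) ∧ (∀ l, IsAlgebraic ℚ (a l)) ∧ c = ∑ l, a l • ρ l

variable (L : PeriodPair)

/-! ### Algebraic coefficients of the standard forms -/

/-- `dlogV T t` is over `ℚ̄`. [folklore] -/
theorem hasAlgCoeffs_dlogV {T : Finset ℂ} (hT : ∀ a ∈ T, IsAlgebraic ℚ a) (t : ℂ) : ∀ i, HasAlgCoeffs (dlogV T t i) := by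
  intro i
  simp only [dlogV]
  fin_cases i
  · simpa using hasAlgCoeffs_invX hT t
  · simpa using (hasAlgCoeffs_zero (n := 3))
  · simpa using (hasAlgCoeffs_zero (n := 3))

/-- `Xi L T t` is over `ℚ̄`. [folklore] -/
theorem hasAlgCoeffs_Xi (h₂ : IsAlgebraic ℚ L.g₂) (h₃ : IsAlgebraic ℚ L.g₃) {T : Finset ℂ} (hT : ∀ a ∈ T, IsAlgebraic ℚ a)
    (t : ℂ) : ∀ i, HasAlgCoeffs (Xi L T t i) := fun i => by
  rw [Xi, Pi.smul_apply, smul_eq_mul]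
  exact (hasAlgCoeffs_invX hT t).mul (hasAlgCoeffs_Theta0 L h₂ h₃ i)

/-! ### The image path along `ι` and the transfer of `Θ₀`, `Θ₁` -/

/-- The image `ι ∘ γ` of a path on `C_T` is a path on `E_L`. [folklore] -/
theorem exists_iotaPath (T : Finset ℂ) (γ : CurvePath (curveP L T)) :
    ∃ δ : CurvePath (curve L), ∀ t, δ.toFun t = fun j => eval (γ.toFun t) (iota j) :=
  RetractionPaths.exists_mapPath (Z := curveP L T) (Z' := curve L) iota hasAlgCoeffs_iota (iota_mapsTo_P L T) γ

/-- **`(C_T, Θ₀, γ) ∼ (E_L, θ₀, ι∘γ)`** ((R4) along `ι`). [cite: HuberWustholz2022, §13.1 (B)] -/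
theorem span_Theta0 (h₂ : IsAlgebraic ℚ L.g₂) (h₃ : IsAlgebraic ℚ L.g₃) {T : Finset ℂ} (hT : ∀ a ∈ T, IsAlgebraic ℚ a)
    (γ : CurvePath (curveP L T)) (δ : CurvePath (curve L)) (hδ : ∀ t, δ.toFun t = fun j => eval (γ.toFun t) (iota j)) :
    InSpan (Finsupp.single (⟨curveP L T, smoothP L h₂ h₃ hT, Theta0 L, hasAlgCoeffs_Theta0 L h₂ h₃, γ⟩ : PeriodSymbol) (1 : ℂ) -
      Finsupp.single (⟨curve L, smooth L h₂ h₃, theta0 L, hasAlgCoeffs_theta0 L h₂ h₃, δ⟩ : PeriodSymbol) (1 : ℂ)) := by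
  have hET := smoothP L h₂ h₃ hT
  have hE := smooth L h₂ h₃
  have hθ := hasAlgCoeffs_theta0 L h₂ h₃
  have hΘ := hasAlgCoeffs_Theta0 L h₂ h₃
  have hω : Theta0 L = formPullback iota (theta0 L) := rfl
  have rι := IsElementaryRelation.pushforward (curveP L T) (curve L) hET hE iota hasAlgCoeffs_iota
    (iota_mapsTo_P L T) (theta0 L) hθ (Theta0 L) hΘ hω γ δ (fun t _ => by rw [hδ t])
  exact span_of_rel rι

/-- **`(C_T, Θ₁, γ) ∼ (E_L, θ₁, ι∘γ)`** ((R4) along `ι`). [cite: HuberWustholz2022, §13.1 (B)] -/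
theorem span_Theta1 (h₂ : IsAlgebraic ℚ L.g₂) (h₃ : IsAlgebraic ℚ L.g₃) {T : Finset ℂ} (hT : ∀ a ∈ T, IsAlgebraic ℚ a)
    (γ : CurvePath (curveP L T)) (δ : CurvePath (curve L)) (hδ : ∀ t, δ.toFun t = fun j => eval (γ.toFun t) (iota j)) :
    InSpan (Finsupp.single (⟨curveP L T, smoothP L h₂ h₃ hT, Theta1 L, hasAlgCoeffs_Theta1 L h₂ h₃, γ⟩ : PeriodSymbol) (1 : ℂ) -
      Finsupp.single (⟨curve L, smooth L h₂ h₃, theta1 L, hasAlgCoeffs_theta1 L h₂ h₃, δ⟩ : PeriodSymbol) (1 : ℂ)) := by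
  have hET := smoothP L h₂ h₃ hT
  have hE := smooth L h₂ h₃
  have hθ := hasAlgCoeffs_theta1 L h₂ h₃
  have hΘ := hasAlgCoeffs_Theta1 L h₂ h₃
  have hω : Theta1 L = formPullback iota (theta1 L) := rfl
  have rι := IsElementaryRelation.pushforward (curveP L T) (curve L) hET hE iota hasAlgCoeffs_iota
    (iota_mapsTo_P L T) (theta1 L) hθ (Theta1 L) hΘ hω γ δ (fun t _ => by rw [hδ t])
  exact span_of_rel rι

/-! ### The transfer of `dx/(x − t)` to `𝔾ₘ` -/

/-- **`(C_T, dx/(x − t), γ) ∼ (𝔾ₘ, y dx, (x − t, (x − t)⁻¹) ∘ γ)`** for `t ∈ T` ((R4) along the unit `x − t` of `C_T`).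
[cite: HuberWustholz2022, §13.1 (B)] -/
theorem span_dlogV (h₂ : IsAlgebraic ℚ L.g₂) (h₃ : IsAlgebraic ℚ L.g₃) {T : Finset ℂ} (hT : ∀ a ∈ T, IsAlgebraic ℚ a)
    {t : ℂ} (ht : t ∈ T) (γ : CurvePath (curveP L T)) :
    ∃ γ' : CurvePath (⟨2, 1, ![X 0 * X 1 - 1]⟩ : CurveData),
      (∀ s, γ'.toFun s = ![γ.toFun s 0 - t, eval (γ.toFun s) (invX T t)]) ∧
      InSpan (Finsupp.single (⟨curveP L T, smoothP L h₂ h₃ hT, dlogV T t, hasAlgCoeffs_dlogV hT t, γ⟩ : PeriodSymbol) (1 : ℂ) -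
        Finsupp.single (⟨⟨2, 1, ![X 0 * X 1 - 1]⟩, isSmoothAffineCurve_mulGroup, ![X 1, 0], hasAlgCoeffs_ydx, γ'⟩ :
          PeriodSymbol) (1 : ℂ)) := by
  classical
  let f : Fin 2 → MvPolynomial (Fin 3) ℂ := ![X 0 - C t, invX T t]
  have hf : ∀ j, HasAlgCoeffs (f j) := by
    intro j
    fin_cases j
    · simpa [f] using (hasAlgCoeffs_X (n := 3) 0).sub (hasAlgCoeffs_C (hT t ht))
    · simpa [f] using hasAlgCoeffs_invX hT t
  have hevf : ∀ q : Fin 3 → ℂ, (fun j => eval q (f j)) = ![q 0 - t, eval q (invX T t)] := by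
    intro q; funext j; fin_cases j <;> simp [f]
  have hfZ : ∀ q ∈ (curveP L T).points, (fun j => eval q (f j)) ∈ (⟨2, 1, ![X 0 * X 1 - 1]⟩ : CurveData).points := by
    intro q hq
    rw [hevf, mem_points_mulGroup_iff]
    simp only [Matrix.cons_val_zero, Matrix.cons_val_one]
    rw [eval_invX_of_mem ht hq]
    have hq' := hq
    rw [mem_points_curveP_iff] at hq'
    have hx : ∏ a ∈ T, (q 0 - a) ≠ 0 := fun h => by simp [h] at hq'
    exact mul_inv_cancel₀ (Finset.prod_ne_zero_iff.1 hx t ht)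
  have hω : dlogV T t = formPullback f ![X 1, 0] := by
    funext k
    fin_cases k
    · simp [dlogV, formPullback, f, Fin.sum_univ_two, pderiv_X]
    · simp [dlogV, formPullback, f, Fin.sum_univ_two, pderiv_X, invX, cofP, Derivation.leibniz]
    · simp [dlogV, formPullback, f, Fin.sum_univ_two, pderiv_X, invX, cofP, Derivation.leibniz]
  obtain ⟨γ', hγ'⟩ := RetractionPaths.exists_mapPath (Z := curveP L T) (Z' := ⟨2, 1, ![X 0 * X 1 - 1]⟩) f hf hfZ γ
  refine ⟨γ', fun s => by rw [hγ' s, hevf], ?_⟩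
  exact span_of_rel (IsElementaryRelation.pushforward (curveP L T) ⟨2, 1, ![X 0 * X 1 - 1]⟩ (smoothP L h₂ h₃ hT)
    isSmoothAffineCurve_mulGroup f hf hfZ ![X 1, 0] hasAlgCoeffs_ydx _ (hasAlgCoeffs_dlogV hT t) hω γ γ'
    fun s _ => hγ' s)


/-! ### The chain rule along `ψ_T` and the pairings of the standard forms with `ψ_T′` -/

/-- **Chain rule** for a multivariate polynomial along a complex path. [folklore] -/
theorem hasDerivAt_eval_comp_complex {n : ℕ} {γ : ℂ → (Fin n → ℂ)} {γ' : Fin n → ℂ} {t : ℂ}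
    (hγ : ∀ i, HasDerivAt (fun u => γ u i) (γ' i) t) (P : MvPolynomial (Fin n) ℂ) :
    HasDerivAt (fun u => eval (γ u) P) (∑ i, eval (γ t) (pderiv i P) * γ' i) t := by
  induction P using MvPolynomial.induction_on with
  | C a =>
    simp only [eval_C, pderiv_C, map_zero, zero_mul, Finset.sum_const_zero]
    exact hasDerivAt_const t a
  | add p q hp hq =>
    have h := hp.add hq
    simp only [map_add, add_mul, Finset.sum_add_distrib]
    exact h
  | mul_X p i hp =>
    have h := hp.mul (hγ i)
    have key : ∀ k, eval (γ t) (pderiv k (p * X i)) * γ' k =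
        eval (γ t) (pderiv k p) * γ' k * γ t i + (if k = i then eval (γ t) p * γ' i else 0) := by
      intro k
      rw [pderiv_mul, map_add, map_mul, map_mul, eval_X]
      by_cases hk : k = i
      · subst hk
        rw [pderiv_X_self, map_one, if_pos rfl]
        ring
      · rw [pderiv_X_of_ne (fun h => hk h.symm), map_zero, if_neg hk]
        ring
    have hsum : (∑ k, eval (γ t) (pderiv k (p * X i)) * γ' k) =
        (∑ k, eval (γ t) (pderiv k p) * γ' k) * γ t i + eval (γ t) p * γ' i := by
      rw [Finset.sum_congr rfl fun k _ => key k, Finset.sum_add_distrib, Finset.sum_mul,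
        Finset.sum_ite_eq' Finset.univ i, if_pos (Finset.mem_univ _)]
    have e : (fun u => eval (γ u) (p * X i)) = (fun u => eval (γ u) p) * fun u => γ u i := by
      funext u; simp [map_mul]
    rw [hsum, e]
    exact h

/-- The chain rule along `ψ_T`: `d/dz P(ψ_T z) = Σᵢ (∂ᵢP)(ψ_T z) ψ_T′(z)ᵢ`. [folklore] -/
theorem hasDerivAt_eval_psiP (T : Finset ℂ) {z : ℂ} (hz : z ∉ L.lattice) (hne : prodFun L T z ≠ 0)
    (P : MvPolynomial (Fin 3) ℂ) :
    HasDerivAt (fun w => eval (psiP L T w) P) (∑ i, eval (psiP L T z) (pderiv i P) * psiPD L T z i) z :=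
  hasDerivAt_eval_comp_complex (hasDerivAt_psiP L T hz hne) P

/-- `Θ₀` pairs with `ψ_T′(z)` to `2` (`φ^*θ₀ = 2 dz`). [cite: HuberWustholz2022, §18.1] -/
theorem Theta0_pair_psiPD : ∀ (L : PeriodPair) (T : Finset ℂ) {z : ℂ}, z ∉ L.lattice → ∑ i, eval (psiP L T z) (Theta0 L i) * psiPD L T z i = 2 := by
  intro L T z hz
  rw [Theta0, formPullback_pair, iota_psiP]
  have hs : ∑ j, eval (phi L z) (theta0 L j) * (∑ i, eval (psiP L T z) (pderiv i (iota j)) * psiPD L T z i) =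
      ∑ j, eval (phi L z) (theta0 L j) * phiD L z j :=
    Finset.sum_congr rfl fun j _ => by rw [pair_pderiv_iota_P L T z j]
  rw [hs, theta0_phi L hz]

/-- `Θ₁` pairs with `ψ_T′(z)` to `2℘(z)`. [cite: HuberWustholz2022, §18.1] -/
theorem Theta1_pair_psiPD (T : Finset ℂ) {z : ℂ} (hz : z ∉ L.lattice) :
    ∑ i, eval (psiP L T z) (Theta1 L i) * psiPD L T z i = 2 * ℘[L] z := by
  rw [Theta1, formPullback_pair, iota_psiP]
  have hs : ∑ j, eval (phi L z) (theta1 L j) * (∑ i, eval (psiP L T z) (pderiv i (iota j)) * psiPD L T z i) =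
      ∑ j, eval (phi L z) (theta1 L j) * phiD L z j :=
    Finset.sum_congr rfl fun j _ => by rw [pair_pderiv_iota_P L T z j]
  rw [hs, theta1_phi L hz]

/-- A scalar multiple `Q • ν` pairs to `Q(p)` times the pairing of `ν`. [folklore] -/
theorem smul_pair (Q : MvPolynomial (Fin 3) ℂ) (ν : Fin 3 → MvPolynomial (Fin 3) ℂ) (p v : Fin 3 → ℂ) :
    ∑ i, eval p ((Q • ν) i) * v i = eval p Q * ∑ i, eval p (ν i) * v i := by
  rw [Finset.mul_sum]
  refine Finset.sum_congr rfl fun i _ => ?_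
  simp only [Pi.smul_apply, smul_eq_mul, map_mul]
  ring

/-- A constant multiple `c • ν` pairs to `c` times the pairing of `ν`. [folklore] -/
theorem const_smul_pair (c : ℂ) (ν : Fin 3 → MvPolynomial (Fin 3) ℂ) (p v : Fin 3 → ℂ) :
    ∑ i, eval p ((c • ν) i) * v i = c * ∑ i, eval p (ν i) * v i := by
  rw [Finset.mul_sum]
  refine Finset.sum_congr rfl fun i _ => ?_
  simp only [Pi.smul_apply, smul_eval]
  ring

/-- `ξ_t = dx/((x − t) y)` pairs with `ψ_T′(z)` to `2/(℘ z − t)` (`t ∈ T`). [folklore] -/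
theorem Xi_pair_psiPD {T : Finset ℂ} {t : ℂ} (ht : t ∈ T) {z : ℂ} (hz : z ∉ L.lattice) (hne : prodFun L T z ≠ 0) :
    ∑ i, eval (psiP L T z) (Xi L T t i) * psiPD L T z i = 2 * (℘[L] z - t)⁻¹ := by
  rw [Xi, smul_pair, Theta0_pair_psiPD L T hz, eval_invX_psiP L ht hne]
  ring

/-! ### `ξ_t` at a `2`-torsion abscissa is of the second kind -/

/-- The derivative of `z ↦ (℘′ z/2)/(℘ z − t)` for a root `t` of `f`: `(℘ z − t) − f′(t)/(℘ z − t)`. [folklore] -/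
theorem hasDerivAt_half_derivWeierstrassP_div {t : ℂ} (hft : t ^ 3 + A L * t + B L = 0) {z : ℂ} (hz : z ∉ L.lattice)
    (hzt : ℘[L] z ≠ t) :
    HasDerivAt (fun w => ℘'[L] w / 2 / (℘[L] w - t)) ((℘[L] z - t) - (3 * t ^ 2 + A L) / (℘[L] z - t)) z := by
  have h0 := hasDerivAt_phi L hz 0
  have h1 := hasDerivAt_phi L hz 1
  simp only [phi_apply_zero, phiD_apply_zero, phi_apply_one, phiD_apply_one] at h0 h1
  have hd := h1.div (h0.sub_const t) (sub_ne_zero.2 hzt)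
  refine hd.congr_deriv ?_
  have hsq := L.derivWeierstrassP_sq z hz
  have hsub : ℘[L] z - t ≠ 0 := sub_ne_zero.2 hzt
  have hA : A L = -(L.g₂ / 4) := rfl
  have hB : B L = -(L.g₃ / 4) := rfl
  rw [hA] at hft ⊢
  rw [hB] at hft
  field_simp
  linear_combination (-4 : ℂ) * hsq - 16 * hft

/-- **At a `2`-torsion abscissa `t ∈ T` (`f(t) = 0`) the third-kind form `ξ_t` is of the second kind**:
`d(y/(x − t)) − ½ θ₁ + (t/2) θ₀ + (f′(t)/2) ξ_t` vanishes on `C_T`. [cite: HuberWustholz2022, §13.2] -/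
theorem vanishesOn_xi_twoTorsion {T : Finset ℂ} (hE : (curveP L T).IsSmoothAffineCurve) {t : ℂ} (ht : t ∈ T)
    (hft : t ^ 3 + A L * t + B L = 0) :
    VanishesOn (curveP L T)
      (formD (X 1 * invX T t) - (1 / 2 : ℂ) • Theta1 L + (t / 2) • Theta0 L + ((3 * t ^ 2 + A L) / 2) • Xi L T t) := by
  refine vanishesOn_curveP_of_psi L hE _ fun z hz hne => ?_
  have hzt : ℘[L] z ≠ t := (prodFun_ne_zero_iff L T z).1 hne t ht
  -- the pairing of `d(y/(x − t))` is the derivative of `z ↦ (℘′ z/2)/(℘ z − t)`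
  have hD1 := hasDerivAt_eval_psiP L T hz hne (X 1 * invX T t)
  have hD2 := hasDerivAt_half_derivWeierstrassP_div L hft hz hzt
  have hev' : ∀ᶠ w in 𝓝 z, prodFun L T w ≠ 0 := (hasDerivAt_prodFun L T hz).continuousAt.eventually_ne hne
  have hev : (fun w => ℘'[L] w / 2 / (℘[L] w - t)) =ᶠ[𝓝 z] fun w => eval (psiP L T w) (X 1 * invX T t) := by
    filter_upwards [hev'] with w hw
    rw [map_mul, eval_X, eval_invX_psiP L ht hw, psiP_apply_one]
    ring
  have hderiv := (hD1.congr_of_eventuallyEq hev).unique hD2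
  have hsum : ∑ i, eval (psiP L T z) ((formD (X 1 * invX T t) - (1 / 2 : ℂ) • Theta1 L + (t / 2) • Theta0 L +
        ((3 * t ^ 2 + A L) / 2) • Xi L T t : Fin 3 → MvPolynomial (Fin 3) ℂ) i) * psiPD L T z i =
      (∑ i, eval (psiP L T z) (pderiv i (X 1 * invX T t)) * psiPD L T z i) -
        (1 / 2 : ℂ) * (∑ i, eval (psiP L T z) (Theta1 L i) * psiPD L T z i) +
        (t / 2) * (∑ i, eval (psiP L T z) (Theta0 L i) * psiPD L T z i) +
        ((3 * t ^ 2 + A L) / 2) * (∑ i, eval (psiP L T z) (Xi L T t i) * psiPD L T z i) := by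
    rw [← const_smul_pair, ← const_smul_pair, ← const_smul_pair, ← Finset.sum_sub_distrib, ← Finset.sum_add_distrib,
      ← Finset.sum_add_distrib]
    refine Finset.sum_congr rfl fun i _ => ?_
    simp only [formD, Pi.add_apply, Pi.sub_apply, map_add, map_sub]
    ring
  rw [hsum, hderiv, Theta1_pair_psiPD L T hz, Theta0_pair_psiPD L T hz, Xi_pair_psiPD L ht hz hne]
  have hsub : ℘[L] z - t ≠ 0 := sub_ne_zero.2 hzt
  field_simp
  ring

end TorsionLayer

end Summit.KontsevichZagierPeriods.SymplecticScissors.RealOnePeriodRelations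

end
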